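import Literature.NumberTheory.Sieve.QuadraticRootsPrimeModuliDFIBilinearFibres
import HarnessLib

/-!
# Duke–Friedlander–Iwaniec 1995, §7 (iii-c): "(35) follows from Proposition 2" (PROVED)

Topic `Literature/NumberTheory/Sieve`.  For `f = aX² + 2bX + c ∈ ℤ[X]` with `ac − b² > 0`, `h ≥ 1`
and `0 < ε ≤ 1/12`, DFI's Proposition 2 (the named fact
`Literature.NumberTheory.Sieve.dukeFriedlanderIwaniec1995_proposition2`) implies hypothesis
(35) of Theorem 5 for `c_n = ρ_h(n)`:
`R(w, y) = ∑_{w ≤ n < y} β_n ∑_{(m,n)=1, mn ≤ x} α_m ρ_h(mn) ≪ x (log x)^{−10}` with `y = x^{1/3−ε}`,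
`w = x^{(log log x)^{−3}}`, uniformly in `|α_m| ≤ ω(m)` and `|β_n| ≤ 1` supported on primes
(`DFI1995.hyp35_of_proposition2 : … → DFI1995.Hyp35 (quad a b c) h ε`) — the second of the two
deductions of §7 of W. Duke, J. B. Friedlander, H. Iwaniec, Ann. of Math. 141 (1995), p. 438,
which the paper leaves to the reader.

## The argument (`DFI1995.norm_sieveR₂_rho_le`, then `DFI1995.hyp35_final_bound`)

With `L = 1 + log x` and `Δ = L^{−14}`, cut the range `w ≤ n < y` into the `K = ⌈log(y/w)/log(1+Δ)⌉ ≤ 3L^{15}`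
short multiplicative fibres `N_k ≤ n < N_{k+1}`, `N_k = w(1+Δ)^k`.  On a fibre the cutoff
`m ≤ x/n` is replaced by the fixed `m ≤ x/N_{k+1}` at a total cost (over all fibres, by the
short-interval divisor bound of the previous file) of `8C_f log x (L(ΔxL + y) + y√x)`; the fibre sum
with the fixed cutoff is decomposed dyadically in `m` and each block is bounded by Proposition 2
(previous file), giving per fibre
`(2 log x + 1) K₂ 2C_f log x √(L³) (√2 x/√w + √3 x^{7/8+ε/8} y^{3/8})` — the first term uses
`N_{k+1}/2 ≥ w/2` and `#fibre ≤ 2N'Δ + 1` (`DFI1995.fiber_term1_le`), the second `N' ≤ y`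
(`DFI1995.fiber_term2_le`).  Finally `L^{19} x/√w` and `L^{19} x^{1−ε/4}` are both `≤ x(log x)^{−10}`
for large `x`: `√w = exp(log x/(2(log log x)³))` beats every power of `log x`
(`DFI1995.exists_pow_four_mul_le_exp`: `C u⁴ ≤ e^u`, `u = log log x`), and `(log x)^{29} = o(x^{ε/4})`.
Everything in this file is proved.

## References

* W. Duke, J. B. Friedlander, H. Iwaniec, Ann. of Math. (2) 141 (1995), 423–441: Proposition 2
  (p. 426, (10)), (33) and (35) (pp. 436–437), §7 (p. 438). [cite: DukeFriedlanderIwaniec1995, §7]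
-/

namespace Literature.NumberTheory.Sieve

open scoped BigOperators Polynomial
open Filter Asymptotics Finset Polynomial

namespace DFI1995

/-! ### (35) for `ρ_h` from Proposition 2 -/

/-- `K = ⌈log(y/w)/log(1+Δ)⌉ ≤ 2 log x/Δ + 1` for `1 ≤ w`, `0 < y ≤ x`, `0 < Δ ≤ 1`. [folklore] -/
theorem natCeil_log_div_log_le {x w y Δ : ℝ} (hx : 1 ≤ x) (hw : 1 ≤ w) (hy0 : 0 < y) (hyx : y ≤ x)
    (hΔ0 : 0 < Δ) (hΔ1 : Δ ≤ 1) :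
    (⌈Real.log (y / w) / Real.log (1 + Δ)⌉₊ : ℝ) ≤ 2 * Real.log x / Δ + 1 := by
  have hlog1Δ : Δ / 2 ≤ Real.log (1 + Δ) := half_mul_le_log_one_add hΔ0.le hΔ1
  have hlog1Δ0 : 0 < Real.log (1 + Δ) := by linarith
  have hlogyw : Real.log (y / w) ≤ Real.log x := by
    rw [Real.log_div hy0.ne' (by linarith)]
    have h1 : Real.log y ≤ Real.log x := Real.log_le_log hy0 hyx
    have h2 : 0 ≤ Real.log w := Real.log_nonneg hw
    linarith
  have hlx : 0 ≤ Real.log x := Real.log_nonneg hx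
  have ht : Real.log (y / w) / Real.log (1 + Δ) ≤ 2 * Real.log x / Δ := by
    calc Real.log (y / w) / Real.log (1 + Δ) ≤ Real.log x / Real.log (1 + Δ) :=
          div_le_div_of_nonneg_right hlogyw hlog1Δ0.le
      _ ≤ Real.log x / (Δ / 2) := div_le_div_of_nonneg_left hlx (by positivity) hlog1Δ
      _ = 2 * Real.log x / Δ := by field_simp
  have h0 : 0 ≤ 2 * Real.log x / Δ := by positivity
  calc (⌈Real.log (y / w) / Real.log (1 + Δ)⌉₊ : ℝ) ≤ (⌈2 * Real.log x / Δ⌉₊ : ℝ) := by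
        exact_mod_cast Nat.ceil_mono ht
    _ ≤ 2 * Real.log x / Δ + 1 := (Nat.ceil_lt_add_one h0).le

/-- The final bookkeeping of `hyp35_of_proposition2`: with `L = 1 + log x`, `Δ = L^{−14}`, the
bound of `norm_sieveR₂_rho_le` is `≤ (8C + 3) x (log x)^{−10}` once `(64C+1)(log x)^{12} ≤ x^{1/6}`,
`C_P (log x)^{29} ≤ x^{ε/4}` and `2(|log C_M| + 29) u⁴ ≤ e^u` (`u = log log x`). [folklore] -/
theorem hyp35_final_bound {Cρ K₂ ε x w y CM CP u : ℝ} (hCρ0 : 0 ≤ Cρ) (hK₂ : 0 ≤ K₂)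
    (hCM : CM = 12 * Real.sqrt 2 * 2 ^ 19 * K₂ * Cρ + 1)
    (hCP : CP = 12 * Real.sqrt 3 * 2 ^ 19 * K₂ * Cρ + 1)
    (hx1 : 1 ≤ x) (hlogx : 1 ≤ Real.log x) (heu : Real.exp u = Real.log x) (hu1' : 1 ≤ u)
    (hgrowth : 2 * (|Real.log CM| + 29) * u ^ 4 ≤ Real.exp u)
    (h64 : (64 * Cρ + 1) * Real.log x ^ 12 ≤ x ^ (1 / 6 : ℝ))
    (hCPb : CP * Real.log x ^ 29 ≤ x ^ (ε / 4))
    (hsqrtw : Real.sqrt w = Real.exp (Real.exp u / (2 * u ^ 3))) (hw1 : 1 ≤ w)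
    (hy : y = x ^ (1 / 3 - ε)) (hy0 : 0 < y) (hyx : y ≤ x) (hy13 : y ≤ x ^ (1 / 3 : ℝ)) :
    8 * Cρ * Real.log x * ((1 + Real.log x) * ((1 + Real.log x)⁻¹ ^ 14 * x * (1 + Real.log x) + y) +
        y * Real.sqrt x) +
      (⌈Real.log (y / w) / Real.log (1 + (1 + Real.log x)⁻¹ ^ 14)⌉₊ : ℝ) *
        ((2 * Real.log x + 1) * (K₂ * (2 * Cρ * Real.log x) * Real.sqrt ((1 + Real.log x) ^ 3)) *
          (Real.sqrt 2 * x / Real.sqrt w + Real.sqrt 3 * x ^ (7 / 8 + ε / 8) * y ^ (3 / 8 : ℝ))) ≤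
      (8 * Cρ + 3) * x / Real.log x ^ 10 := by
  have hx0 : 0 < x := by linarith
  have hCM0 : 0 < CM := by rw [hCM]; positivity
  have hu0 : 0 < u := by linarith
  set L : ℝ := 1 + Real.log x with hL
  have hL1 : 1 ≤ L := by linarith
  have hLlog : Real.log x ≤ L := by linarith
  have hL2log : L ≤ 2 * Real.log x := by linarith
  set Δ : ℝ := L⁻¹ ^ 14 with hΔ
  have hΔ0 : 0 < Δ := by positivity
  have hΔ1 : Δ ≤ 1 := by
    rw [hΔ, inv_pow]; exact inv_le_one_of_one_le₀ (one_le_pow₀ hL1)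
  have hlx0 : 0 < Real.log x := by linarith
  have hl10 : 0 < Real.log x ^ 10 := by positivity
  set Q : ℝ := x / Real.log x ^ 10 with hQ
  have hQ0 : 0 ≤ Q := by positivity
  -- (E1) `8 Cρ log x · L · Δ x L ≤ 8 Cρ Q`
  have hE1 : 8 * Cρ * Real.log x * ((1 + Real.log x) * ((1 + Real.log x)⁻¹ ^ 14 * x * (1 + Real.log x))) ≤
      8 * Cρ * Q := by
    rw [← hL]
    have h1 : Real.log x * (L * (L⁻¹ ^ 14 * x * L)) = x * (Real.log x / L ^ 12) := by
      have hL0 : L ≠ 0 := by linarith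
      rw [inv_pow]
      field_simp
    rw [mul_assoc (8 * Cρ), h1, hQ]
    refine mul_le_mul_of_nonneg_left ?_ (by positivity)
    rw [mul_div_assoc']
    rw [div_le_div_iff₀ (by positivity) hl10]
    have h2 : Real.log x ^ 11 ≤ L ^ 11 := pow_le_pow_left₀ hlx0.le hLlog 11
    have h3 : L ^ 11 ≤ L ^ 12 := pow_le_pow_right₀ hL1 (by norm_num)
    calc x * Real.log x * Real.log x ^ 10 = x * Real.log x ^ 11 := by ring
      _ ≤ x * L ^ 12 := by gcongr; exact h2.trans h3
  -- (E2) `8 Cρ log x (L y + y √x) ≤ Q`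
  have hE2 : 8 * Cρ * Real.log x * ((1 + Real.log x) * y + y * Real.sqrt x) ≤ Q := by
    rw [← hL]
    have hsx1 : 1 ≤ Real.sqrt x := by rw [← Real.sqrt_one]; exact Real.sqrt_le_sqrt hx1
    have h1 : L * y + y * Real.sqrt x ≤ 2 * L * Real.sqrt x * y := by
      have ha : L * y ≤ L * Real.sqrt x * y := by
        calc L * y = L * 1 * y := by ring
          _ ≤ L * Real.sqrt x * y := by gcongr
      have hb : y * Real.sqrt x ≤ L * Real.sqrt x * y := by
        calc y * Real.sqrt x = 1 * Real.sqrt x * y := by ring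
          _ ≤ L * Real.sqrt x * y := by gcongr
      linarith
    have h2 : Real.sqrt x * y ≤ x ^ (5 / 6 : ℝ) := by
      rw [Real.sqrt_eq_rpow]
      calc x ^ (1 / 2 : ℝ) * y ≤ x ^ (1 / 2 : ℝ) * x ^ (1 / 3 : ℝ) :=
            mul_le_mul_of_nonneg_left hy13 (by positivity)
        _ = x ^ (5 / 6 : ℝ) := by rw [← Real.rpow_add hx0]; norm_num
    have h3 : (64 * Cρ + 1) * Real.log x ^ 12 ≤ x ^ (1 / 6 : ℝ) := h64
    have h4 : x ^ (5 / 6 : ℝ) * x ^ (1 / 6 : ℝ) = x := by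
      rw [← Real.rpow_add hx0]; norm_num
    calc 8 * Cρ * Real.log x * (L * y + y * Real.sqrt x)
        ≤ 8 * Cρ * Real.log x * (2 * L * Real.sqrt x * y) := by gcongr
      _ = 16 * Cρ * (Real.log x * L) * (Real.sqrt x * y) := by ring
      _ ≤ 16 * Cρ * (Real.log x * (2 * Real.log x)) * x ^ (5 / 6 : ℝ) := by gcongr
      _ = (32 * Cρ * Real.log x ^ 12) * x ^ (5 / 6 : ℝ) / Real.log x ^ 10 := by
          field_simp; ring
      _ ≤ x ^ (1 / 6 : ℝ) * x ^ (5 / 6 : ℝ) / Real.log x ^ 10 := by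
          gcongr
          nlinarith [pow_nonneg hlx0.le 12]
      _ = Q := by rw [hQ, mul_comm, h4]
  -- (K) the number of fibres
  have hK : (⌈Real.log (y / w) / Real.log (1 + (1 + Real.log x)⁻¹ ^ 14)⌉₊ : ℝ) ≤ 3 * L ^ 15 := by
    rw [← hL, ← hΔ]
    refine (natCeil_log_div_log_le hx1 hw1 hy0 hyx hΔ0 hΔ1).trans ?_
    have h1 : 2 * Real.log x / Δ = 2 * Real.log x * L ^ 14 := by
      rw [hΔ, inv_pow]; field_simp
    rw [h1]
    have h2 : (1 : ℝ) ≤ L ^ 15 := one_le_pow₀ hL1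
    calc 2 * Real.log x * L ^ 14 + 1 ≤ 2 * L * L ^ 14 + L ^ 15 := by gcongr
      _ = 3 * L ^ 15 := by ring
  -- (MF) the fibre bound in terms of `L`
  have hMF : (2 * Real.log x + 1) * (K₂ * (2 * Cρ * Real.log x) * Real.sqrt ((1 + Real.log x) ^ 3)) ≤
      4 * K₂ * Cρ * L ^ 4 := by
    rw [← hL]
    have h1 : Real.sqrt (L ^ 3) ≤ L ^ 2 := by
      rw [show L ^ 2 = Real.sqrt (L ^ 4) by
        rw [show L ^ 4 = (L ^ 2) ^ 2 by ring, Real.sqrt_sq (by positivity)]]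
      exact Real.sqrt_le_sqrt (pow_le_pow_right₀ hL1 (by norm_num))
    calc (2 * Real.log x + 1) * (K₂ * (2 * Cρ * Real.log x) * Real.sqrt (L ^ 3))
        ≤ (2 * L) * (K₂ * (2 * Cρ * L) * L ^ 2) := by gcongr; linarith
      _ = 4 * K₂ * Cρ * L ^ 4 := by ring
  -- (M1) the `w`-term
  have hM1 : 3 * L ^ 15 * (4 * K₂ * Cρ * L ^ 4) * (Real.sqrt 2 * x / Real.sqrt w) ≤ Q := by
    have hsw0 : 0 < Real.sqrt w := Real.sqrt_pos.2 (by linarith)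
    -- `CM (log x)^29 ≤ √w`
    have hgr : CM * Real.log x ^ 29 ≤ Real.sqrt w := by
      have h1 : CM * Real.log x ^ 29 = Real.exp (Real.log CM + 29 * u) := by
        rw [Real.exp_add, Real.exp_log hCM0, ← heu, ← Real.exp_nat_mul]; norm_num
      rw [h1, hsqrtw, Real.exp_le_exp, le_div_iff₀ (by positivity)]
      have h2 : Real.log CM ≤ |Real.log CM| * u := by
        calc Real.log CM ≤ |Real.log CM| := le_abs_self _
          _ = |Real.log CM| * 1 := (mul_one _).symm
          _ ≤ |Real.log CM| * u := by gcongr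
      have h5 : Real.log CM * (2 * u ^ 3) ≤ |Real.log CM| * u * (2 * u ^ 3) :=
        mul_le_mul_of_nonneg_right h2 (by positivity)
      calc (Real.log CM + 29 * u) * (2 * u ^ 3)
          = Real.log CM * (2 * u ^ 3) + 29 * u * (2 * u ^ 3) := by ring
        _ ≤ |Real.log CM| * u * (2 * u ^ 3) + 29 * u * (2 * u ^ 3) := by linarith
        _ = 2 * (|Real.log CM| + 29) * u ^ 4 := by ring
        _ ≤ Real.exp u := hgrowth
    have hL19 : L ^ 19 ≤ 2 ^ 19 * Real.log x ^ 19 :=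
      calc L ^ 19 ≤ (2 * Real.log x) ^ 19 := pow_le_pow_left₀ (by linarith) hL2log 19
        _ = 2 ^ 19 * Real.log x ^ 19 := mul_pow _ _ _
    have hcoef : 3 * L ^ 15 * (4 * K₂ * Cρ * L ^ 4) * Real.sqrt 2 ≤ CM * Real.log x ^ 19 := by
      have hc1 : 12 * Real.sqrt 2 * 2 ^ 19 * K₂ * Cρ ≤ CM := by rw [hCM]; linarith
      calc 3 * L ^ 15 * (4 * K₂ * Cρ * L ^ 4) * Real.sqrt 2 = 12 * Real.sqrt 2 * K₂ * Cρ * L ^ 19 := by ring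
        _ ≤ 12 * Real.sqrt 2 * K₂ * Cρ * (2 ^ 19 * Real.log x ^ 19) :=
            mul_le_mul_of_nonneg_left hL19 (by positivity)
        _ = (12 * Real.sqrt 2 * 2 ^ 19 * K₂ * Cρ) * Real.log x ^ 19 := by ring
        _ ≤ CM * Real.log x ^ 19 := mul_le_mul_of_nonneg_right hc1 (by positivity)
    calc 3 * L ^ 15 * (4 * K₂ * Cρ * L ^ 4) * (Real.sqrt 2 * x / Real.sqrt w)
        = (3 * L ^ 15 * (4 * K₂ * Cρ * L ^ 4) * Real.sqrt 2) * (x / Real.sqrt w) := by ring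
      _ ≤ (CM * Real.log x ^ 19) * (x / Real.sqrt w) :=
          mul_le_mul_of_nonneg_right hcoef (by positivity)
      _ = (CM * Real.log x ^ 29 / Real.sqrt w) * Q := by
          rw [hQ]; field_simp
      _ ≤ 1 * Q := by
          refine mul_le_mul_of_nonneg_right ?_ hQ0
          rw [div_le_one hsw0]; exact hgr
      _ = Q := one_mul Q
  -- (M2) the power-saving term
  have hM2 : 3 * L ^ 15 * (4 * K₂ * Cρ * L ^ 4) *
      (Real.sqrt 3 * x ^ (7 / 8 + ε / 8) * y ^ (3 / 8 : ℝ)) ≤ Q := by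
    have hCP0 : 0 < CP := by rw [hCP]; positivity
    have hpow : x ^ (7 / 8 + ε / 8) * y ^ (3 / 8 : ℝ) = x ^ (1 - ε / 4) := by
      rw [hy, ← Real.rpow_mul hx0.le, ← Real.rpow_add hx0]
      congr 1; ring
    have hgr : CP * Real.log x ^ 29 ≤ x ^ (ε / 4) := hCPb
    have hL19 : L ^ 19 ≤ 2 ^ 19 * Real.log x ^ 19 :=
      calc L ^ 19 ≤ (2 * Real.log x) ^ 19 := pow_le_pow_left₀ (by linarith) hL2log 19
        _ = 2 ^ 19 * Real.log x ^ 19 := mul_pow _ _ _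
    have hcoef : 3 * L ^ 15 * (4 * K₂ * Cρ * L ^ 4) * Real.sqrt 3 ≤ CP * Real.log x ^ 19 := by
      have hc1 : 12 * Real.sqrt 3 * 2 ^ 19 * K₂ * Cρ ≤ CP := by rw [hCP]; linarith
      calc 3 * L ^ 15 * (4 * K₂ * Cρ * L ^ 4) * Real.sqrt 3 = 12 * Real.sqrt 3 * K₂ * Cρ * L ^ 19 := by ring
        _ ≤ 12 * Real.sqrt 3 * K₂ * Cρ * (2 ^ 19 * Real.log x ^ 19) :=
            mul_le_mul_of_nonneg_left hL19 (by positivity)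
        _ = (12 * Real.sqrt 3 * 2 ^ 19 * K₂ * Cρ) * Real.log x ^ 19 := by ring
        _ ≤ CP * Real.log x ^ 19 := mul_le_mul_of_nonneg_right hc1 (by positivity)
    have hx1e : x ^ (ε / 4) * x ^ (1 - ε / 4) = x := by
      rw [← Real.rpow_add hx0]; norm_num
    calc 3 * L ^ 15 * (4 * K₂ * Cρ * L ^ 4) * (Real.sqrt 3 * x ^ (7 / 8 + ε / 8) * y ^ (3 / 8 : ℝ))
        = (3 * L ^ 15 * (4 * K₂ * Cρ * L ^ 4) * Real.sqrt 3) * (x ^ (7 / 8 + ε / 8) * y ^ (3 / 8 : ℝ)) := by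
          ring
      _ ≤ (CP * Real.log x ^ 19) * x ^ (1 - ε / 4) := by
          rw [hpow]; exact mul_le_mul_of_nonneg_right hcoef (by positivity)
      _ = (CP * Real.log x ^ 29) * x ^ (1 - ε / 4) / Real.log x ^ 10 := by
          field_simp
      _ ≤ x ^ (ε / 4) * x ^ (1 - ε / 4) / Real.log x ^ 10 := by gcongr
      _ = Q := by rw [hx1e]
  -- assemble
  have hKM : (⌈Real.log (y / w) / Real.log (1 + (1 + Real.log x)⁻¹ ^ 14)⌉₊ : ℝ) *
      ((2 * Real.log x + 1) * (K₂ * (2 * Cρ * Real.log x) * Real.sqrt ((1 + Real.log x) ^ 3)) *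
        (Real.sqrt 2 * x / Real.sqrt w + Real.sqrt 3 * x ^ (7 / 8 + ε / 8) * y ^ (3 / 8 : ℝ))) ≤ Q + Q := by
    have hT0 : 0 ≤ Real.sqrt 2 * x / Real.sqrt w + Real.sqrt 3 * x ^ (7 / 8 + ε / 8) * y ^ (3 / 8 : ℝ) := by
      have : 0 ≤ y ^ (3 / 8 : ℝ) := Real.rpow_nonneg hy0.le _
      positivity
    calc _ ≤ (3 * L ^ 15) * ((4 * K₂ * Cρ * L ^ 4) *
          (Real.sqrt 2 * x / Real.sqrt w + Real.sqrt 3 * x ^ (7 / 8 + ε / 8) * y ^ (3 / 8 : ℝ))) := by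
          apply mul_le_mul hK (mul_le_mul_of_nonneg_right hMF hT0) (by positivity) (by positivity)
      _ = 3 * L ^ 15 * (4 * K₂ * Cρ * L ^ 4) * (Real.sqrt 2 * x / Real.sqrt w) +
          3 * L ^ 15 * (4 * K₂ * Cρ * L ^ 4) * (Real.sqrt 3 * x ^ (7 / 8 + ε / 8) * y ^ (3 / 8 : ℝ)) := by
          ring
      _ ≤ Q + Q := add_le_add hM1 hM2
  have hE : 8 * Cρ * Real.log x * ((1 + Real.log x) * ((1 + Real.log x)⁻¹ ^ 14 * x * (1 + Real.log x) + y) +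
      y * Real.sqrt x) ≤ 8 * Cρ * Q + Q := by
    have : 8 * Cρ * Real.log x * ((1 + Real.log x) * ((1 + Real.log x)⁻¹ ^ 14 * x * (1 + Real.log x) + y) +
        y * Real.sqrt x) =
        8 * Cρ * Real.log x * ((1 + Real.log x) * ((1 + Real.log x)⁻¹ ^ 14 * x * (1 + Real.log x))) +
          8 * Cρ * Real.log x * ((1 + Real.log x) * y + y * Real.sqrt x) := by ring
    rw [this]
    exact add_le_add hE1 hE2
  calc _ ≤ (8 * Cρ * Q + Q) + (Q + Q) := add_le_add hE hKM
    _ = (8 * Cρ + 3) * x / Real.log x ^ 10 := by rw [hQ]; ring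

/-- **(35) for `ρ_h` from Proposition 2** (the second deduction of §7): for
`f = aX² + 2bX + c` (`ac > b²`), `h ≥ 1`, `0 < ε ≤ 1/12`, Proposition 2 gives hypothesis (35) of
Theorem 5 for `c_n = ρ_h(n)`: `R(w, y) ≪ x (log x)^{−10}` with `y = x^{1/3−ε}`,
`w = x^{(log log x)^{−3}}`, uniformly in `|α_m| ≤ ω(m)`, `|β_n| ≤ 1` supported on primes.
[cite: DukeFriedlanderIwaniec1995, §7 p. 438] -/
theorem hyp35_of_proposition2 (H2 : dukeFriedlanderIwaniec1995_proposition2) {a b c : ℤ}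
    (hD : 0 < a * c - b ^ 2) {h : ℕ} (hh : 1 ≤ h) {ε : ℝ} (hε : 0 < ε) (hε12 : ε ≤ 1 / 12) :
    Hyp35 (quad a b c) h ε := by
  obtain ⟨Cρ, hCρ, hρ⟩ := exists_norm_polyRootWeylSum_quad_le hD
  have hCρ0 : 0 ≤ Cρ := by linarith
  set ε' : ℝ := ε / 8 with hε'
  have hε'0 : 0 < ε' := by positivity
  obtain ⟨K₂, hK₂, hK₂all⟩ := exists_norm_block_le H2 hD hh hε'0
  -- thresholds
  -- (a) the growth lemma for `u = log log x`
  set CM : ℝ := 12 * Real.sqrt 2 * 2 ^ 19 * K₂ * Cρ + 1 with hCM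
  have hCM0 : 0 < CM := by positivity
  obtain ⟨u₀, hu₀⟩ := exists_pow_four_mul_le_exp (2 * (|Real.log CM| + 29))
  -- (b) `64 Cρ (log x)^12 ≤ x^{1/6}` and (c) `C (log x)^29 ≤ x^{ε/4}` eventually
  have hb := (isLittleO_log_rpow_rpow_atTop (12 : ℝ) (by norm_num : (0 : ℝ) < 1 / 6)).bound
    (show (0 : ℝ) < 1 / (64 * Cρ + 1) by positivity)
  obtain ⟨x₂, hx₂⟩ := Filter.eventually_atTop.1 hb
  set CP : ℝ := 12 * Real.sqrt 3 * 2 ^ 19 * K₂ * Cρ + 1 with hCP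
  have hc := (isLittleO_log_rpow_rpow_atTop (29 : ℝ) (by positivity : (0 : ℝ) < ε / 4)).bound
    (show (0 : ℝ) < 1 / CP by positivity)
  obtain ⟨x₃, hx₃⟩ := Filter.eventually_atTop.1 hc
  set x₁ : ℝ := max (max (Real.exp (Real.exp (max u₀ 1))) (Real.exp 1)) (max x₂ x₃) with hx₁
  refine ⟨x₁, 8 * Cρ + 3, fun x hx α β hα hβ hβp => ?_⟩
  have hxu : Real.exp (Real.exp (max u₀ 1)) ≤ x := le_trans (le_trans (le_max_left _ _) (le_max_left _ _)) hx
  have hxe : Real.exp 1 ≤ x := le_trans (le_trans (le_max_right _ _) (le_max_left _ _)) hx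
  have hx₂x : x₂ ≤ x := le_trans (le_trans (le_max_left _ _) (le_max_right _ _)) hx
  have hx₃x : x₃ ≤ x := le_trans (le_trans (le_max_right _ _) (le_max_right _ _)) hx
  have hx1 : (1 : ℝ) ≤ x := le_trans (by have := Real.add_one_le_exp (1 : ℝ); linarith) hxe
  have hx0 : (0 : ℝ) < x := by linarith
  have hlogx : 1 ≤ Real.log x := by
    rw [← Real.log_exp 1]; exact Real.log_le_log (Real.exp_pos 1) hxe
  set u : ℝ := Real.log (Real.log x) with hu
  have hu1 : max u₀ 1 ≤ u := by
    have h1 : Real.exp (max u₀ 1) ≤ Real.log x := by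
      rw [← Real.log_exp (Real.exp (max u₀ 1))]
      exact Real.log_le_log (Real.exp_pos _) hxu
    rw [hu, ← Real.log_exp (max u₀ 1)]
    exact Real.log_le_log (Real.exp_pos _) h1
  have hu1' : 1 ≤ u := le_trans (le_max_right _ _) hu1
  have heu : Real.exp u = Real.log x := by rw [hu, Real.exp_log (by linarith)]
  have hgrowth : 2 * (|Real.log CM| + 29) * u ^ 4 ≤ Real.exp u := hu₀ u (le_trans (le_max_left _ _) hu1)
  -- the parameters
  set L : ℝ := 1 + Real.log x with hL
  have hL1 : 1 ≤ L := by linarith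
  have hLlog : Real.log x ≤ L := by linarith
  have hL2log : L ≤ 2 * Real.log x := by linarith
  set Δ : ℝ := L⁻¹ ^ 14 with hΔ
  have hΔ0 : 0 < Δ := by positivity
  have hΔ1 : Δ ≤ 1 := by
    rw [hΔ, inv_pow]; exact inv_le_one_of_one_le₀ (one_le_pow₀ hL1)
  set w : ℝ := x ^ ((Real.log (Real.log x))⁻¹ ^ 3) with hw
  set y : ℝ := x ^ (1 / 3 - ε) with hy
  have hy0 : 0 < y := Real.rpow_pos_of_pos hx0 _
  have hyx : y ≤ x := by
    calc y ≤ x ^ (1 : ℝ) := Real.rpow_le_rpow_of_exponent_le hx1 (by linarith)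
      _ = x := Real.rpow_one x
  have hy13 : y ≤ x ^ (1 / 3 : ℝ) := Real.rpow_le_rpow_of_exponent_le hx1 (by linarith)
  -- `√w = exp(e^u/(2u³))` and `w ≥ 2`
  have hsqrtw : Real.sqrt w = Real.exp (Real.exp u / (2 * u ^ 3)) := by
    rw [hw, Real.rpow_def_of_pos hx0, ← Real.exp_half, ← hu, heu]
    congr 1
    field_simp
  have hu0 : 0 < u := by linarith
  have hexpu : u ^ 3 * u ≤ Real.exp u := by
    have h58 : (1 : ℝ) ≤ 2 * (|Real.log CM| + 29) := by
      have := abs_nonneg (Real.log CM); linarith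
    calc u ^ 3 * u = 1 * u ^ 4 := by ring
      _ ≤ 2 * (|Real.log CM| + 29) * u ^ 4 := by gcongr
      _ ≤ Real.exp u := hgrowth
  have hw2 : 2 ≤ w := by
    have h1 : Real.log 2 ≤ Real.exp u / (2 * u ^ 3) * 2 := by
      rw [div_mul_eq_mul_div, le_div_iff₀ (by positivity)]
      have hl2 := Real.log_two_lt_d9
      have hu3 : 0 ≤ u ^ 3 := pow_nonneg hu0.le 3
      have h3 : u ^ 3 ≤ Real.exp u := le_trans (by nlinarith) hexpu
      nlinarith
    have h2 : (2 : ℝ) ≤ Real.sqrt w * Real.sqrt w := by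
      rw [hsqrtw, ← Real.exp_add, ← two_mul]
      calc (2 : ℝ) = Real.exp (Real.log 2) := (Real.exp_log (by norm_num)).symm
        _ ≤ Real.exp (2 * (Real.exp u / (2 * u ^ 3))) := Real.exp_le_exp.2 (by linarith)
    have hw0 : 0 ≤ w := by rw [hw]; exact Real.rpow_nonneg hx0.le _
    rwa [Real.mul_self_sqrt hw0] at h2
  have hw1 : 1 ≤ w := by linarith
  -- the bound at `x`
  have hmain := norm_sieveR₂_rho_le (f := quad a b c) (h := (h : ℤ)) (w := w) (y := y) (α := α) (β := β)
    hCρ0 hK₂ hε'0.le hρ hK₂all hα hβ hβp hxe hw2 hy0.le hyx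
  refine hmain.trans ?_
  have h64 : (64 * Cρ + 1) * Real.log x ^ 12 ≤ x ^ (1 / 6 : ℝ) := by
    have := hx₂ x hx₂x
    rw [show (12 : ℝ) = ((12 : ℕ) : ℝ) by norm_num, Real.rpow_natCast,
      Real.norm_of_nonneg (by positivity), Real.norm_of_nonneg (by positivity)] at this
    rw [← le_div_iff₀' (by positivity)]
    simpa [one_div, div_eq_inv_mul] using this
  have hCP0 : 0 < CP := by positivity
  have hCPb : CP * Real.log x ^ 29 ≤ x ^ (ε / 4) := by
    have := hx₃ x hx₃x
    rw [show (29 : ℝ) = ((29 : ℕ) : ℝ) by norm_num, Real.rpow_natCast,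
      Real.norm_of_nonneg (by positivity), Real.norm_of_nonneg (by positivity)] at this
    rw [← le_div_iff₀' hCP0]
    simpa [one_div, div_eq_inv_mul] using this
  exact hyp35_final_bound hCρ0 hK₂ hCM hCP hx1 hlogx heu hu1' hgrowth h64 hCPb hsqrtw hw1 hy hy0
    hyx hy13

end DFI1995

end Literature.NumberTheory.Sieve
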